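import Literature.MathematicalPhysics.QuantumFieldTheory.Balaban1983to89.B11LeafKnitTwoTier
import Literature.MathematicalPhysics.QuantumFieldTheory.Balaban1983to89.BlockAveragingSectionPlaq
import Literature.MathematicalPhysics.QuantumFieldTheory.Balaban1983to89.Node00.Record11Carriers
import Summits.QuantumFields.YangMills.Theorems.BalabanUVNodesN07AtRecordCarriersZ

/-!
# BalabanUVNodes ∕ N07 ([B11], `Dag.B11_main`) — THE REPAIRED SCALE TOWER `B11Thm1TwoTier.TowerT` INSTANTIATED AT NODE 00's OBJECTS:
# Theorem 1 over the WHOLE family of record `famVOfRecord F N ζ` (every torus `K`, every level `k ≤ K`, ONE block of constants, B₃″ = κ₀B₃) and the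
# background-free Proposition 7 DERIVED by the Sect.-A induction from Props 2, 5, 6, 8, Sect. F, the Sect.-A leaves PROVED at the torus of record;
# the [B11] leaf at the bundle of record `Z11OfRecord F N ζ`; N07 at the ₁₁ carrier record `Node00.IsRecordOfRecord₁₁CB10YZW`

Track A of `YM-PLAN.md` (cell `pub-ymgap`, HUMAN RULING D-0062), node **N07** = [Balaban1985Variational] = T. Bałaban, *The variational problem and
background fields in renormalization group method for lattice gauge theories*, Commun. Math. Phys. **102** (1985) 277–309, Thm 1 p. 279 + Props 2–9
pp. 281–309; seat `pub-ymgap-dag-n07-d` (R134 fan-out, strategy s3 = dag-lead FAN-OUT v1.1 §N07 «REPAIRED-TOWER CURRENCY»).  THEOREMS ONLY (0 `def`,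
0 `sorry`, standard axioms); COUNT-NEUTRAL; `--supports stmt-QuantumFields-19674`.  CONTENT consumed BY NAME, nothing restated: unit b2b-balaban-b11-g4's
`B11Thm1TwoTier` (the two-tier hypothesis (7″), covariant V₀, `thm1TAt_allLevels`, `background_of_thm1TAt`), n07-a's `B11LeafKnitTwoTier`
(`thm1TAt_towerT_of_parts`, `prop7Printed_towerT_of_parts`), r08's `B11Prop7Assembly` (bridges, capped existence leaves), node00-def's `CarriersZ`
(`ZIdx`, `ResidZ`, `famXOfRecord`, `Z11OfRecord`) and `Record11Carriers` (the ₁₁ four-pin view and its leaves), n07-a's `B11Thm1CarrierT` ∕ `…LevelZero`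
∕ `BalabanUVNodesN07AtRecordCarriersZ.laws_famXOfRecord`, n01-b's `Node00.InUkClassB11` with `B10Eq68TorusRegularity` ((2) on the torus, both clauses).

THE TOWER OF RECORD (built INSIDE the proofs as a structure literal — no definition is introduced).  For a residual [B11] layer `ζ : ResidZ F N`:
tower level `n` = print's `k` (number of averaging steps); index `T.I n := {K : ℕ // n ≤ K}` (≃ `ZIdx`); member `T.fam n ⟨K, _⟩ :=` n07-a's carrier
`famXOfRecord F N ζ ⟨K, n, _⟩` ITSELF (Theorem 1's problem (5)–(6) at NODE 00's objects: `InUkClassB11`, `avOfRecord`, `PlaqSmall`, `IsBackground`,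
`OrbitRel`) with `Near b V U :=` its own field `InB V U` («Ū^n = V» — EXACT block averages, print's (11) «V̄₀ = V on Λ_k» and (13) «U₀ ∈ … ∩ 𝔅_k(𝔅_k, V)»;
the slack «|Ū₀ − V| < C₁ε₁» of (14) is not needed at Ω_j = T, `C₁′ := 0`); `T.L := F.L`; `drop` = the same torus one level down; `lift := id` (a
configuration of the level-`k` problem IS one of the level-`(k+1)` problem: both live on the finest torus); `base := id` (level `k = 0`: `U₀ = V`, p. 280
«we take simply U₀ = V₀»); `RegT n i ε V := PlaqSmall (κ₀ε) V` — LOCATED READING: at `Ω_k = T` one has `Ω_kᶜ = ∅`, so EVERY top-level plaquette lies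
«≥ 2L^kη inside Ω_k» and the two-tier class (7″)(ε₁, κ₀) of `B11Thm1TwoTier` IS (7)[κ₀ε₁]; the interface objection G-B11-A1b (multi-domain case
`Λ_{k−1} ≠ ∅`: the word `printed_interface_word` of `B11V0Interface` §3) never occurs on the torus of record, every word is `interior_backforth` or a
coarse plaquette (κ₀ ≥ 1 is kept as a parameter; κ₀ = 1 is the printed tower, §4); `V0 = V0c := BlockAveragingSection.faceSec` — print's (11) p. 279
«V₀,b = V_b′ for b ∈ B(b′), b′ ∈ Λ_k and V₀,b = 1 for remaining bonds of B(Λ_k)» AS A TERM (cell ym3-torus, seat ym3-torus-p1: the bonds EXITING their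
block carry the coarse variable, the remaining bonds carry 1).
THE FOUR SECT.-A LAWS OF THE TOWER ARE THEOREMS AT THE TORUS OF RECORD (proof-local `have cl ∕ hA11 ∕ hA13 ∕ hK1`): `ClassLaws` (κ₀ ≥ 1, `PlaqSmall`
monotone in ε via `eps_pos_of_plaqSmall`, clauses 4–5 `id`); `StepA11T` = (11) «V₀ satisfies (7)» with the SAME ε₁ — `BlockAveragingSectionPlaq.plaqSmall_faceSec`
(every fine plaquette variable of V₀ is 1 or a coarse plaquette variable; G-B11-A1 is a THEOREM on the torus); `StepA13T` = (13) «from the form (2)» —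
§1's `inUkClassB11_succ_of_inUkClassB11` (C₁ = L³ EXACTLY as printed: plaquette thresholds scale by L², the η-free divergence thresholds by L³) ∧ (11)
«V̄₀ = V on Λ_k» EXACTLY at the averaging of record `avOfRecord F N K k = blockAvg expMeanLogSU` — `BlockAveragingSection.blockAvg_faceSec` with the side
condition `E(1, …, 1) = 1` of the printed exp[mean log] proved locally (guard `‖1 − 1‖ = 0 < δ_N`); `BaseK1T` (k = 0: `U₀ = V`, G-B11-A2) =
`B11Thm1LevelZero.inUkClassB11_zero_of_plaqSmall` (7κ₀ε₁) + `inUkClassB11_mono` (7 ≤ L³ ≤ C₁B₃).  WHAT REMAINS DISPLAYED AS HYPOTHESES: the bridges `β`,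
`bg`, `hbg14`, `Bridge.Laws`, `ExistenceLeavesCap` of `B11Prop7Assembly` ((15)–(18) p. 280, (112)–(142) pp. 294–299: the Sect. A–E carrier of Props 2, 5, 6
read against the Theorem-1 carrier); the dictionary residuals `hcrit` («minimal ⇒ critical» for `ζ.IsCrit`) ∕ `hloc` (local-minimum half of the restriction
law) of `laws_famXOfRecord` (D-B11-2); the printed statements Props 2, 5, 6 over `ζ.famLG`, Prop 8 and Sect. F over `famXOfRecord F N ζ` (the induction's
inputs), and for the leaf its own Props 2–6, 8, Sect. F, 9; the constant relations B₀ ≤ 4B₁, B₃ ≥ 1, L³ ≤ C₁, κ₀ ≥ 1.  NOTHING of Sect. A is displayed.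
§1 `eps_pos_of_plaqSmall`, `eps_pos_of_inUkClassB11`, **`inUkClassB11_succ_of_inUkClassB11`** ((13) at objects).  §2 `b11_main_at_view₁₁B10YZW_of_leaf` (N07 at every run
of a world bound to the ₁₁ four-pin view presenting `ζ`, from the leaf at `Z11OfRecord F N ζ`), `exists_record₁₁CB10YZW_b11_main_of_leaf` (∃-direction: a
`Node00.IsRecordOfRecord₁₁CB10YZW` record over the Stage-11 datum at every run of which N07 HOLDS).  §3 **`thm1At_prop7_famOfRecord_of_towerT_parts`**
(Theorem 1″ ⇒ Theorem 1 at every member of the family of record, ONE block of constants `C.B₃ = B₃κ₀`, AND `Prop7Printed (B₃κ₀) ζ.C₁ (famXOfRecord F N ζ)` —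
`B11LeafKnitTwoTier.thm1TAt_towerT_of_parts` ∕ `prop7Printed_towerT_of_parts` BY NAME on the tower of record).  §3 **`b11Leaf_Z11OfRecord_of_towerT_parts`** (the
leaf at the bundle of record for `ζ.B₃ = B₃κ₀`: `t1`, `p7` DERIVED; the leaf's own Props 2–6, 8, Sect. F at `ζ.B₃` and Prop 9 verbatim — two instances of the
same B₃-generic typed statements, as in `B11LeafKnitTwoTier.b11Leaf_towerT_of_parts`, ref-C READ #10 condition (e));
**`exists_record₁₁CB10YZW_b11_main_of_towerT_parts`** (a ₁₁CB10YZW record over the Stage-11 datum at every run of which N07 HOLDS, given the tower parts at `ζ`); the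
∀-form `S_N07` over the cumulative record stays junk-refutable through `ResidZ` (`BalabanUVNodesN07AtRecordCarriersZ.not_s_N07_record₁₀CB10YZ`), closers keyed
to presented packages are n07-a's `BalabanUVNodesN07AtRecord11`.  §4 `b11Leaf_Z11OfRecord_of_towerT_parts_kappa_one` (κ₀ = 1: the PRINTED tower at the torus of
record, every statement at ONE constant `ζ.B₃`).
HONEST FRAMING.  Count-neutral kernel composition: the repaired induction's ARCHITECTURE (Sect. A pp. 279–280 re-organised around (7″), cell record
V0-REPAIR.md) INSTANTIATED at NODE 00's objects, its Sect.-A leaves theorems there, every other non-printed input DISPLAYED (bridges, `hcrit`∕`hloc`);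
[B11] Theorem 1 for `k ≥ 1` is proved nowhere in the tree EXCEPT THROUGH the displayed printed statements Props 2, 5, 6, 8, Sect. F over `ζ`'s families
(tree inhabitants exist on MODEL families only: `B11Prop5Model`, `B11Prop6Concrete`, `B11SectFAssembly`, `B11Prop9Model`); N07 is NOT discharged (5∕27
untouched); one finite four-torus programme at fixed `ε` — NOT ℝ⁴, NOT infinite volume, NOT OS, NOT a mass gap, NOT Clay.  Restate-immune (no `def`).
-/

noncomputable section

namespace Summit.QuantumFields.YangMills.BalabanUVNodes.N07AtRecordTwoTier

open Literature.MathematicalPhysics.QuantumFieldTheory.Balaban1983to89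
open Literature.MathematicalPhysics.QuantumFieldTheory.Balaban1983to89.T4Continuum (T4Family FiniteEpsData)
open Literature.MathematicalPhysics.QuantumFieldTheory.Balaban1983to89.DagBinding
open Literature.MathematicalPhysics.QuantumFieldTheory.Balaban1983to89.Node00
open Literature.MathematicalPhysics.QuantumFieldTheory.Balaban1983to89.B11Thm1 (Thm1At)
open Literature.MathematicalPhysics.QuantumFieldTheory.Balaban1983to89.B11Thm1TwoTier (TowerT)
open Literature.MathematicalPhysics.QuantumFieldTheory.Balaban1983to89.B11Thm1CarrierT (RegCarrierT varProblemT)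
open Literature.MathematicalPhysics.QuantumFieldTheory.Balaban1983to89.B11Prop7Assembly (Bridge ExistenceLeavesCap)
open Literature.MathematicalPhysics.QuantumFieldTheory.Balaban1983to89.BlockAveragingSection (faceSec blockAvg_faceSec)
open Literature.MathematicalPhysics.QuantumFieldTheory.Balaban1983to89.BlockAveragingSectionPlaq (plaqSmall_faceSec)
open Literature.MathematicalPhysics.QuantumFieldTheory.Balaban1983to89.ExpMeanLog (expMeanLogSU)
open Summit.QuantumFields.YangMills.BalabanUVNodes.N07AtRecordCarriersZ (laws_famXOfRecord)
open scoped Matrix.Norms.L2Operator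

variable {N : ℕ} [NeZero N]

/-! ## §1 «The form (2) of the regularity conditions» at `Ω_j = T`: (13) at NODE 00's objects, and two positivity remarks -/

section FormTwo
variable {F : T4Family}

/-- **(7) at a datum forces `ε > 0`** (the torus `T^{(j)}` has a plaquette and `|V(∂p) − 1| ≥ 0`). [cite: Balaban1985Variational, (7) p.278 (bookkeeping)] -/
theorem eps_pos_of_plaqSmall {K j : ℕ} {ε : ℝ} {V : GaugeField (F.P K) j (SU N)} (h : PlaqSmall ε V) : 0 < ε := by
  let p : Plaq (F.P K) j := ⟨default, ⟨0, by simp⟩, ⟨1, by simp⟩, Fin.mk_lt_mk.mpr Nat.zero_lt_one⟩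
  exact (GaugeGroup.dist1_nonneg _).trans_lt (h p)

/-- **Membership in [B11] (2)'s space `𝔘_k({T}, e)` forces `e > 0`** (its scale-`k` plaquette clause at one plaquette of the finest torus).
[cite: Balaban1985Variational, (2) p.278 (bookkeeping)] -/
theorem eps_pos_of_inUkClassB11 {K k : ℕ} {e : ℝ} {U : GaugeField (F.P K) 0 (SU N)} (h : InUkClassB11 F N K k e U) : 0 < e := by
  have hη : 0 < (F.P K).eta k := pow_pos (inv_pos.mpr (Nat.cast_pos.mpr (F.P K).L_pos)) k
  have h1 : PlaqSmall (e * (F.P K).eta k ^ 2) U := (mem_bgReg_iff F N K k e U).1 h.mem_bgReg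
  have h2 : 0 < e * (F.P K).eta k ^ 2 := eps_pos_of_plaqSmall h1
  by_contra he
  exact absurd h2 (not_lt.mpr (mul_nonpos_of_nonpos_of_nonneg (not_lt.mp he) (by positivity)))

/-- **(12) ⇒ (13) AT NODE 00's OBJECTS — «from the form (2) of the regularity conditions»** (p. 280): in the no-holes case `Ω_0 = … = Ω_{k+1} = T` a
configuration of [B11] (2)'s space `𝔘_k({T}, e)` (n01-b's `Node00.InUkClassB11`, BOTH clauses of (2) for `j ≤ k`, `η_k = L^{−k}`) lies in
`𝔘_{k+1}({T}, L³e)`: the scale-`j` clauses for `j ≤ k` are monotone in the constant, and the NEW scale-`(k+1)` clauses follow from the scale-`k` ones because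
the plaquette threshold `e·L^{−2j}` scales by `L²` and the (η-free, `B10Eq68TorusRegularity.regDivAt_iff_unit`) divergence threshold `e·L^{−3j}` by `L³` —
print's `C₁ = L³` («The configuration U₀ constructed above satisfies (14) with C₁ = L³»). [cite: Balaban1985Variational, (12)–(14) p.280, (2) p.278] -/
theorem inUkClassB11_succ_of_inUkClassB11 {K k : ℕ} {e : ℝ} {U : GaugeField (F.P K) 0 (SU N)} (h : InUkClassB11 F N K k e U) :
    InUkClassB11 F N K (k + 1) ((F.L : ℝ) ^ 3 * e) U := by
  have he : 0 < e := eps_pos_of_inUkClassB11 h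
  have hLpos : (0 : ℝ) < (F.P K).L := Nat.cast_pos.mpr (F.P K).L_pos
  have hL1 : (1 : ℝ) ≤ (F.P K).L := by exact_mod_cast (F.P K).L_pos
  have hη : ∀ j : ℕ, 0 < (F.P K).eta j := fun j => pow_pos (inv_pos.mpr hLpos) j
  have hL3 : (1 : ℝ) ≤ (F.L : ℝ) ^ 3 := one_le_pow₀ (by exact_mod_cast (F.P K).L_pos : (1 : ℝ) ≤ (F.L : ℝ))
  have hmono : e ≤ (F.L : ℝ) ^ 3 * e := le_mul_of_one_le_left he.le hL3
  -- the two threshold identities behind «the form (2)»: scale k at constant e vs scale k+1 at constant L³e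
  have hPL : ((F.P K).L : ℝ) = (F.L : ℝ) := by rw [T4Family.P_L]
  have hplaq : e * ((((F.P K).L : ℝ) ^ k)⁻¹) ^ 2 ≤ (F.L : ℝ) ^ 3 * e * ((((F.P K).L : ℝ) ^ (k + 1))⁻¹) ^ 2 := by
    rw [hPL] at hLpos hL1 ⊢
    have hx : (0 : ℝ) < (F.L : ℝ) ^ k := pow_pos hLpos k
    have e1 : (F.L : ℝ) ^ 3 * e * (((F.L : ℝ) ^ (k + 1))⁻¹) ^ 2 = (F.L : ℝ) * (e * (((F.L : ℝ) ^ k)⁻¹) ^ 2) := by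
      rw [pow_succ _ k]
      field_simp
    rw [e1]
    exact le_mul_of_one_le_left (by positivity) hL1
  have hdiv : (F.L : ℝ) ^ 3 * e * ((((F.P K).L : ℝ) ^ (k + 1))⁻¹) ^ 3 = e * ((((F.P K).L : ℝ) ^ k)⁻¹) ^ 3 := by
    rw [hPL] at hLpos ⊢
    have hx : (0 : ℝ) < (F.L : ℝ) ^ k := pow_pos hLpos k
    rw [pow_succ _ k]
    field_simp
  intro j hj
  rcases Nat.lt_or_ge j (k + 1) with hjk | hjk
  · -- scales j ≤ k: monotonicity in the constant (plaquettes) and the η-free divergence clause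
    have hjk' : j ≤ k := Nat.lt_succ_iff.mp hjk
    obtain ⟨hP, hD⟩ := h j hjk'
    refine ⟨hP.mono_eps hmono, ?_⟩
    rw [B10Eq68TorusRegularity.regDivAt_iff_unit (hη (k + 1))]
    rw [B10Eq68TorusRegularity.regDivAt_iff_unit (hη k)] at hD
    intro b hb
    exact (hD b hb).trans_le (mul_le_mul_of_nonneg_right hmono (pow_nonneg (inv_nonneg.mpr (pow_pos hLpos j).le) 3))
  · -- the new scale j = k+1 from the scale-k clauses
    obtain rfl : j = k + 1 := le_antisymm hj hjk
    obtain ⟨hP, hD⟩ := h k le_rfl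
    refine ⟨fun q hq => (hP q hq).trans_le hplaq, ?_⟩
    rw [B10Eq68TorusRegularity.regDivAt_iff_unit (hη (k + 1))]
    rw [B10Eq68TorusRegularity.regDivAt_iff_unit (hη k)] at hD
    intro b hb
    exact (hD b hb).trans_eq hdiv.symm

end FormTwo

/-! ## §2 N07 at a world ∕ a record presenting `ζ`, from the [B11] leaf at the bundle of record (generic closers at the ₁₁ four-pin view) -/

section Leaf
variable {F : T4Family}

/-- **N07 AT EVERY RUN OF EVERY WORLD BOUND TO THE ₁₁ FOUR-PIN VIEW PRESENTING `ζ`** (node00-def's `upOfRecord₅C_view₁₁B10YZW_leaves`: the world's `b11`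
IS `B11Leaf (Z11OfRecord F N ζ)`): given the leaf at the bundle of record — e.g. from `b11Leaf_Z11OfRecord_of_towerT_parts` — `Dag.B11_main (leavesP w P)`
(«b5 → b6 → b7 → b8 → b9 → b11»; antecedents not consumed). [cite: Balaban1985Variational, Thm 1 p.279, Props 2–9 pp.281–309 (bookkeeping: the node at a presented world)] -/
theorem b11_main_at_view₁₁B10YZW_of_leaf (θ : Stage11Params F N) (Mstar : ℕ) (ops : OpsY N θ.toStage3Params Mstar) (ζ : ResidZ F N)
    (lamW : ResidW F N) {w : WorldP} (hup : ∀ P, w.up P = upOfRecord₅C F N (θ.view₁₁B10YZW F N Mstar ops ζ lamW) P)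
    (hleaf : B11Leaf (Z11OfRecord F N ζ)) (P : B12.RunParams) : Dag.B11_main (leavesP w P) := by
  intro _ _ _ _ _
  show (w.up P).b11
  rw [hup P]
  exact (upOfRecord₅C_view₁₁B10YZW_leaves F N θ Mstar ops ζ lamW P).2.2.2.2 hleaf

/-- **THE ∃-DIRECTION AT THE ₁₁ CARRIER RECORD**: for every admissible Stage-11 parameter with provisos and `γ > 0`, every floor, operator layer and [IV]
layer, and a residual [B11] layer `ζ` CARRYING THE LEAF (e.g. the tower parts of `b11Leaf_Z11OfRecord_of_towerT_parts`), there is a record of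
`Node00.IsRecordOfRecord₁₁CB10YZW` over the Stage-11 datum at every run of which N07 HOLDS (the world bound to the four-pin view presenting `ζ`;
`Node00.exists_world_isRecordOfRecord₁₁CB10YZW`'s construction). [cite: Balaban1985Variational, Thm 1 p.279, Props 2–9 pp.281–309 (bookkeeping: the node at the ₁₁ record)] -/
theorem exists_record₁₁CB10YZW_b11_main_of_leaf (θ : Stage11Params F N) (h : θ.Provisos₁₁) (hθ : θ.Admissible) (hγ : 0 < θ.γ) (Mstar : ℕ)
    (ops : OpsY N θ.toStage3Params Mstar) (ζ : ResidZ F N) (lamW : ResidW F N) (hleaf : B11Leaf (Z11OfRecord F N ζ)) :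
    ∃ w : WorldP, IsRecordOfRecord₁₁CB10YZW F N (datumOfRecord₁₁ F N θ h) w ∧ ∀ P : B12.RunParams, Dag.B11_main (leavesP w P) := by
  obtain ⟨w₀, -, -⟩ := exists_world_isRecordOfRecord₁₁C F N θ h hθ (γw := θ.γ) ⟨hγ, le_rfl⟩
  refine ⟨{ w₀ with
      C := (datumOfRecord₁₁ F N θ h).C, γ := θ.γ, L := (θ.L : ℝ), one_lt_L := by exact_mod_cast θ.hL.2,
      up := fun P => upOfRecord₅C F N (θ.view₁₁B10YZW F N Mstar ops ζ lamW) P },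
    ⟨θ, h, Mstar, ops, ζ, lamW, hθ, rfl, rfl, ⟨hγ, le_rfl⟩, rfl, fun _ => rfl⟩, fun P => ?_⟩
  exact b11_main_at_view₁₁B10YZW_of_leaf θ Mstar ops ζ lamW (fun _ => rfl) hleaf P

end Leaf

/-! ## §3 Theorem 1 over the family of record, the background-free Proposition 7, the [B11] leaf and N07, by the repaired induction on the tower of record -/

section Tower

/-! The DISPLAYED inputs shared by the theorems of this section (section variables, `include`d): the residual [B11] layer `ζ`, the bridges `β`, `bg` with
`hbg14`, `Bridge.Laws`, `ExistenceLeavesCap` ((15)–(18) p. 280, (112)–(142) pp. 294–299), the dictionary residuals `hcrit` ∕ `hloc` (D-B11-2), the printed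
constant relations, Props 2, 5, 6 over `ζ.famLG` and Prop 8, Sect. F over `famXOfRecord F N ζ` at the Sect.-F constant `B₃`. -/
variable {F : T4Family} (ζ : ResidZ F N)
    (β : ∀ i : ZIdx, Bridge (famXOfRecord F N ζ i) (ζ.famLG i)) (bg : ∀ i : ZIdx, GaugeField (F.P i.K) 0 (SU N) → (ζ.famLG i).Cfg)
    {κ₀ B₃ O₁ O₂ e₅ : ℝ}
    (hbg14 : ∀ (i : ZIdx) (ε : ℝ) (V : GaugeField (F.P i.K) i.k (SU N)) (U : GaugeField (F.P i.K) 0 (SU N)),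
      InUkClassB11 F N i.K i.k (ζ.C₁ * B₃ * ε) U → Averaging.iter (avOfRecord F N i.K) i.k U = V →
        (ζ.famLG i).Sat14 (ζ.C₁ * B₃ * ε) (ζ.C₁ * ε) ((β i).bdry V) (bg i U))
    (laws : ∀ i, (β i).Laws ζ.C₁ B₃) (leaves : ∀ i, ExistenceLeavesCap (β i) ζ.B₀ B₃ ζ.C₁ O₁ O₂ e₅)
    (hcrit : ∀ (i : ZIdx) (e : ℝ) (V : GaugeField (F.P i.K) i.k (SU N)) (U : GaugeField (F.P i.K) 0 (SU N)),
      IsBackground (avOfRecord F N i.K) {U | InUkClassB11 F N i.K i.k e U} i.k V U → ζ.IsCrit i V U)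
    (hloc : ∀ (i : ZIdx) (e e' : ℝ) (V : GaugeField (F.P i.K) i.k (SU N)) (U : GaugeField (F.P i.K) 0 (SU N)), e' < e →
      IsBackground (avOfRecord F N i.K) {U | InUkClassB11 F N i.K i.k e' U} i.k V U →
        IsBackground (avOfRecord F N i.K) {U | InUkClassB11 F N i.K i.k e U} i.k V U)
    (hκ₀ : 1 ≤ κ₀) (hB₀ : 0 < ζ.B₀) (hB₁ : 0 < ζ.B₁) (hB₃ : 1 ≤ B₃) (hC₁L : (F.L : ℝ) ^ 3 ≤ ζ.C₁) (hB₀B₁ : ζ.B₀ ≤ 4 * ζ.B₁)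
    (hc₁ : 0 < ζ.c₁) (hO₁ : 0 < O₁) (hO₂ : 0 < O₂) (he₅ : 0 < e₅)
    (p2 : B11.Prop2Printed ζ.B₁ B₃ ζ.C₁ ζ.c₁ ζ.famLG) (p5 : B11.Prop5Printed ζ.B₁ B₃ ζ.C₁ ζ.famLG) (p6 : B11.Prop6Printed ζ.B₀ B₃ ζ.C₁ ζ.famLG)
    (p8 : B11.Prop8Printed B₃ (famXOfRecord F N ζ)) (sF : B11.SectFPrinted B₃ (famXOfRecord F N ζ))

include hbg14 laws leaves hcrit hloc hκ₀ hB₀ hB₁ hB₃ hC₁L hB₀B₁ hc₁ hO₁ hO₂ he₅ p2 p5 p6 p8 sF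

/-- **THEOREM 1 AT EVERY MEMBER OF THE FAMILY OF RECORD WITH ONE BLOCK OF CONSTANTS (B₃″ = κ₀B₃) AND THE BACKGROUND-FREE PROPOSITION 7 OVER
`famXOfRecord F N ζ` AT (B₃κ₀, C₁), BY THE REPAIRED SECT.-A INDUCTION ON THE TOWER OF RECORD.**  Inputs (displayed): Props 2, 5, 6 over `ζ.famLG` at the
Sect.-F constant `B₃` read through the bridges `β`, `bg` ((15) p. 280) with their located laws, capped existence leaves and the (14)-reading `hbg14`; Prop 8
and Sect. F over `famXOfRecord F N ζ` at `B₃`; the dictionary residuals `hcrit`, `hloc` (D-B11-2); the printed constant relations `B₀ ≤ 4B₁`, `B₃ ≥ 1`,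
`L³ ≤ C₁`, `κ₀ ≥ 1`.  Sect. A is NOT an input: on the tower of record (members `famXOfRecord`, `V₀ := faceSec`, (7″) = (7)[κ₀ε₁]) the leaves `StepA11T`
(`plaqSmall_faceSec`), `StepA13T` (§1 + `blockAvg_faceSec`), `BaseK1T` (`B11Thm1LevelZero`) and the class ∕ dictionary laws are PROVED inside.  Outputs:
`B11LeafKnitTwoTier.thm1TAt_towerT_of_parts` (Theorem 1″ at all levels, hence Theorem 1 by `thm1At_of_thm1TAt`) and `prop7Printed_towerT_of_parts`, read back
on `ZIdx`; `B11.Thm1Printed (Z11OfRecord F N ζ).famV` follows by `B11Thm1CarrierT.thm1Printed_iff_thm1At` (the leaf's `t1` below).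
[cite: Balaban1985Variational, Thm 1 p.279, Sect. A (11)–(14) pp.279–280, Prop. 7 p.299, Prop. 8 p.304, Sect. F (169) p.305] -/
theorem thm1At_prop7_famOfRecord_of_towerT_parts :
    (∃ C : B11Thm1.Consts, C.B₃ = B₃ * κ₀ ∧ ∀ i : ZIdx, Thm1At C (varProblemT F N i.K i.k (ζ.R i))) ∧
      B11.Prop7Printed (B₃ * κ₀) ζ.C₁ (famXOfRecord F N ζ) := by
  -- THE TOWER OF RECORD (structure literal; level n = print's k; members = `famXOfRecord` with `Near :=` its own (3) `InB`, i.e. «Ū^n = V»;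
  -- the background datum V₀ of (11) = ym3-torus's `faceSec` («V₀,b = V_b′ on the bonds exiting their block, 1 on the remaining bonds»)
  let T : TowerT :=
    { I := fun n => {K : ℕ // n ≤ K}
      fam := fun n i => ⟨famXOfRecord F N ζ ⟨i.1, n, i.2⟩, fun _ V U => (famXOfRecord F N ζ ⟨i.1, n, i.2⟩).InB V U⟩
      L := (F.L : ℝ)
      drop := fun n i => ⟨i.1, (Nat.le_succ n).trans i.2⟩
      V0 := fun _ _ V => faceSec V
      lift := fun _ _ U => U
      base := fun _ V => V
      κ₀ := κ₀
      C₁' := 0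
      RegT := fun _ _ ε V => PlaqSmall (κ₀ * ε) V
      V0c := fun _ _ V => faceSec V }
  -- the index dictionary `Σ n, T.I n → ZIdx`
  let e : (Σ n, T.I n) → ZIdx := fun p => ⟨p.2.1, p.1, p.2.2⟩
  have hκ₀pos : 0 < κ₀ := lt_of_lt_of_le one_pos hκ₀
  have hL1 : (1 : ℝ) ≤ T.L := by
    show (1 : ℝ) ≤ (F.L : ℝ)
    exact_mod_cast (F.P 0).L_pos
  have hL3_7 : (7 : ℝ) ≤ (F.L : ℝ) ^ 3 := by
    have h2 : (2 : ℝ) ≤ (F.L : ℝ) := by exact_mod_cast (F.P 0).hL.2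
    nlinarith [h2, mul_le_mul h2 h2 (by norm_num) (by linarith)]
  have h7C : 7 ≤ ζ.C₁ * B₃ := by nlinarith
  -- NODE 00's standing range at a member of positive level: `n + 1 ≤ m + K` from `n + 1 ≤ K`
  have hrange : ∀ (n : ℕ) (i : T.I (n + 1)), n + 1 ≤ (F.P i.1).m + (F.P i.1).K := fun n i => by
    have hi : n + 1 ≤ i.1 := i.2
    rw [T4Family.P_m, T4Family.P_K]
    omega
  -- the printed inner operation exp[mean log] fixes the constant family 1 (guard met: ‖1 − 1‖ = 0 < δ_N)
  have hE : ∀ n : ℕ, (expMeanLogSU (n := Fin N)).E (fun _ : Fin (n + 1) => (1 : SU N)) = 1 := fun n => by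
    have h : ∀ i : Fin (n + 1), ‖(((fun _ => (1 : SU N)) i : SU N) : Matrix (Fin N) (Fin N) ℂ) - 1‖ < ExpMeanLog.deltaSU (Fin N) :=
      fun i => by
        simp only [OneMemClass.coe_one, sub_self, norm_zero]
        exact ExpMeanLog.deltaSU_pos
    apply Subtype.ext
    show ((ExpMeanLog.ESU (fun _ : Fin (n + 1) => (1 : SU N)) : SU N) : Matrix (Fin N) (Fin N) ℂ) = _
    rw [ExpMeanLog.coe_ESU_of_small h, ExpMeanLog.eml_eq_exp]
    simp
  -- the class laws of (7″) at the torus: (7) ⊂ (7)[κ₀ε] ⊂ (7)[κ₀ε]; `Near` is radius-free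
  have cl : T.ClassLaws := by
    refine ⟨hκ₀, le_rfl, fun n i ε V hV => ?_, fun n i ε V hV => hV, fun n i b b' V U _ h => h⟩
    show PlaqSmall (κ₀ * ε) V
    have hε : 0 < ε := eps_pos_of_plaqSmall hV
    exact fun p => (hV p).trans_le (le_mul_of_one_le_left hε.le hκ₀)
  -- print's dictionary at every member: `laws_famXOfRecord` + «Ū^k = V gives Near for every radius»
  have lawsA : ∀ (n : ℕ) (i : T.I n), (T.fam n i).LawsA := fun n i =>
    ⟨laws_famXOfRecord ζ ⟨i.1, n, i.2⟩ (hcrit _) (hloc _), fun _ _ _ _ h => h⟩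
  -- the Sect.-A leaves at objects: (11a) `plaqSmall_faceSec`, (13) §1, (11b) `blockAvg_faceSec` at the averaging of record
  have hA11 : B11Thm1TwoTier.StepA11T T := fun n i ε₁ V hV =>
    plaqSmall_faceSec (hrange n i) (eps_pos_of_plaqSmall hV) hV
  have hA13 : B11Thm1TwoTier.StepA13T T := by
    intro n i ε₁ e₀ V U _ hU hB
    refine ⟨inUkClassB11_succ_of_inUkClassB11 hU, ?_⟩
    show (avOfRecord F N i.1 n).avg (Averaging.iter (avOfRecord F N i.1) n U) = V
    have hB' : Averaging.iter (avOfRecord F N i.1) n U = faceSec V := hB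
    rw [hB', avOfRecord_apply]
    exact blockAvg_faceSec (hrange n i) expMeanLogSU hE V
  have hK1 : B11Thm1TwoTier.BaseK1T T B₃ ζ.C₁ := by
    intro i ε₁ V hε₁ hV
    refine ⟨?_, rfl⟩
    show InUkClassB11 F N i.1 0 (ζ.C₁ * B₃ * (κ₀ * ε₁)) V
    have hV' : InUkClassB11 F N i.1 0 (7 * (κ₀ * ε₁)) V :=
      B11Thm1LevelZero.inUkClassB11_zero_of_plaqSmall F N i.1 (mul_pos hκ₀pos hε₁) hV
    exact B11Thm1CarrierTLevelZero.inUkClassB11_mono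
      (mul_le_mul_of_nonneg_right h7C (mul_pos hκ₀pos hε₁).le) hV'
  -- the bridge data re-indexed on the tower
  have hbg14' : ∀ (p : Σ n, T.I n) (ε : ℝ) (V : (T.fam p.1 p.2).Bdry) (U : (T.fam p.1 p.2).Cfg),
      (T.fam p.1 p.2).Sat14 ζ.C₁ B₃ ε V U →
        (ζ.famLG (e p)).Sat14 (ζ.C₁ * B₃ * ε) (ζ.C₁ * ε) ((β (e p)).bdry V) (bg (e p) U) :=
    fun p ε V U h14 => hbg14 (e p) ε V U h14.1 h14.2
  have p2' : B11.Prop2Printed ζ.B₁ B₃ ζ.C₁ ζ.c₁ (fun p : Σ n, T.I n => ζ.famLG (e p)) := fun p => p2 (e p)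
  have p5' : B11.Prop5Printed ζ.B₁ B₃ ζ.C₁ (fun p : Σ n, T.I n => ζ.famLG (e p)) := by
    obtain ⟨c, hc, H⟩ := p5
    exact ⟨c, hc, fun p => H (e p)⟩
  have p6' : B11.Prop6Printed ζ.B₀ B₃ ζ.C₁ (fun p : Σ n, T.I n => ζ.famLG (e p)) := by
    obtain ⟨a₄, ha₄, H⟩ := p6
    exact ⟨a₄, ha₄, fun p => H (e p)⟩
  have p8' : B11.Prop8Printed B₃ T.famAllX := by
    obtain ⟨a₅, ha₅, H⟩ := p8
    exact ⟨a₅, ha₅, fun p => H (e p)⟩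
  have sF' : B11.SectFPrinted B₃ T.famAllX := by
    obtain ⟨a₁, B₄, RM, ha₁, hB₄, hRM, H⟩ := sF
    exact ⟨a₁, B₄, RM, ha₁, hB₄, hRM, fun p => H (e p)⟩
  have hC₁' : T.C₁' ≤ ζ.C₁ := le_trans (le_refl (0 : ℝ)) (by linarith [one_le_pow₀ (M₀ := ℝ) (n := 3) hL1])
  refine ⟨?_, ?_⟩
  · obtain ⟨C, hCB, H⟩ := B11LeafKnitTwoTier.thm1TAt_towerT_of_parts T (fun p => ζ.famLG (e p)) (fun p => β (e p))
      (fun p U => bg (e p) U) hbg14' (fun p => laws (e p)) (fun p => leaves (e p)) cl lawsA hA11 hA13 hK1 hB₀ hB₁ hB₃ hL1 hC₁L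
      hC₁' hB₀B₁ hc₁ hO₁ hO₂ he₅ p2' p5' p6' p8' sF'
    exact ⟨C, hCB, fun i => B11Thm1TwoTier.thm1At_of_thm1TAt T C cl i.k ⟨i.K, i.hk⟩ (H i.k ⟨i.K, i.hk⟩)⟩
  · obtain ⟨a₀, a₁', O, ha₀, ha₁', hO, H⟩ := B11LeafKnitTwoTier.prop7Printed_towerT_of_parts T (fun p => ζ.famLG (e p))
      (fun p => β (e p)) (fun p U => bg (e p) U) hbg14' (fun p => laws (e p)) (fun p => leaves (e p)) cl lawsA hA11 hA13 hK1 hB₀ hB₁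
      hB₃ hL1 hC₁L hC₁' hB₀B₁ hc₁ hO₁ hO₂ he₅ p2' p5' p6' p8' sF'
    exact ⟨a₀, a₁', O, ha₀, ha₁', hO, fun i => H ⟨i.k, ⟨i.K, i.hk⟩⟩⟩

/-- **THE [B11] LEAF AT THE BUNDLE OF RECORD `Z11OfRecord F N ζ` FROM THE TOWER PARTS** (residual layer with `ζ.B₃ = B₃κ₀`): Theorem 1 (`t1`) and the
background-free Proposition 7 (`p7`) DERIVED by the repaired induction from Props 2, 5, 6, 8, Sect. F at the Sect.-F constant `B₃` (`thm1At_prop7_famOfRecord_of_towerT_parts`); the leaf's own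
instances of Props 2, 3, 4, 5, 6, 8, Sect. F at `ζ.B₃ = B₃κ₀` (`q2 … qF`, the same B₃-generic typed statements at the second constant) and Prop 9 enter
verbatim — the shape of `B11LeafKnitTwoTier.b11Leaf_towerT_of_parts`, now at NODE 00's objects.  Nothing of the series is asserted.
[cite: Balaban1985Variational, Thm 1 p.279, Props 2–9 pp.281–309, Sect. A pp.279–280] -/
theorem b11Leaf_Z11OfRecord_of_towerT_parts (hζ : ζ.B₃ = B₃ * κ₀)
    (q2 : B11.Prop2Printed ζ.B₁ ζ.B₃ ζ.C₁ ζ.c₁ ζ.famLG) (q3 : B11.Prop3Printed ζ.C₁ ζ.B₃ ζ.C₂ ζ.C₃ ζ.B₀ ζ.c1h ζ.c₄ ζ.δ₀ ζ.famLG)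
    (q4 : B11.Prop4Printed ζ.C₁ ζ.B₃ ζ.famLG) (q5 : B11.Prop5Printed ζ.B₁ ζ.B₃ ζ.C₁ ζ.famLG) (q6 : B11.Prop6Printed ζ.B₀ ζ.B₃ ζ.C₁ ζ.famLG)
    (q8 : B11.Prop8Printed ζ.B₃ (famXOfRecord F N ζ)) (qF : B11.SectFPrinted ζ.B₃ (famXOfRecord F N ζ))
    (p9 : B11.Prop9Printed ζ.B₅ ζ.C₁ ζ.β₀ ζ.δ₀ ζ.famAn) :
    B11Leaf (Z11OfRecord F N ζ) := by
  obtain ⟨⟨C, -, H⟩, h7⟩ := thm1At_prop7_famOfRecord_of_towerT_parts ζ β bg hbg14 laws leaves hcrit hloc hκ₀ hB₀ hB₁ hB₃ hC₁L hB₀B₁ hc₁ hO₁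
    hO₂ he₅ p2 p5 p6 p8 sF
  refine ⟨(B11Thm1CarrierT.thm1Printed_iff_thm1At (fun i : ZIdx => i.K) (fun i => i.k) ζ.R).2 ⟨C, H⟩, q2, q3, q4, q5, q6, ?_, q8, qF, p9⟩
  show B11.Prop7Printed ζ.B₃ ζ.C₁ (famXOfRecord F N ζ)
  rw [hζ]
  exact h7

/-- **N07 AT THE ₁₁ CARRIER RECORD FROM THE TOWER PARTS** (composition of `b11Leaf_Z11OfRecord_of_towerT_parts` with the ∃-direction): given an admissible
Stage-11 parameter with provisos and `γ > 0` and a residual [B11] layer `ζ` (`ζ.B₃ = B₃κ₀`) carrying the displayed tower parts, a ₁₁CB10YZW record over the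
Stage-11 datum exists at every run of which `Dag.B11_main` holds — with Theorem 1 and Proposition 7 inside its `b11` leaf DERIVED by the repaired induction.
Hypothesis list = what the repaired road needs at NODE 00's objects for N07; nothing is discharged here. [cite: Balaban1985Variational, Thm 1 p.279, Props 2–9 pp.281–309, Sect. A pp.279–280] -/
theorem exists_record₁₁CB10YZW_b11_main_of_towerT_parts (hζ : ζ.B₃ = B₃ * κ₀) (θ : Stage11Params F N) (h : θ.Provisos₁₁) (hθ : θ.Admissible)
    (hγ : 0 < θ.γ) (Mstar : ℕ) (ops : OpsY N θ.toStage3Params Mstar) (lamW : ResidW F N)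
    (q2 : B11.Prop2Printed ζ.B₁ ζ.B₃ ζ.C₁ ζ.c₁ ζ.famLG) (q3 : B11.Prop3Printed ζ.C₁ ζ.B₃ ζ.C₂ ζ.C₃ ζ.B₀ ζ.c1h ζ.c₄ ζ.δ₀ ζ.famLG)
    (q4 : B11.Prop4Printed ζ.C₁ ζ.B₃ ζ.famLG) (q5 : B11.Prop5Printed ζ.B₁ ζ.B₃ ζ.C₁ ζ.famLG) (q6 : B11.Prop6Printed ζ.B₀ ζ.B₃ ζ.C₁ ζ.famLG)
    (q8 : B11.Prop8Printed ζ.B₃ (famXOfRecord F N ζ)) (qF : B11.SectFPrinted ζ.B₃ (famXOfRecord F N ζ))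
    (p9 : B11.Prop9Printed ζ.B₅ ζ.C₁ ζ.β₀ ζ.δ₀ ζ.famAn) :
    ∃ w : WorldP, IsRecordOfRecord₁₁CB10YZW F N (datumOfRecord₁₁ F N θ h) w ∧ ∀ P : B12.RunParams, Dag.B11_main (leavesP w P) :=
  exists_record₁₁CB10YZW_b11_main_of_leaf θ h hθ hγ Mstar ops ζ lamW
    (b11Leaf_Z11OfRecord_of_towerT_parts ζ β bg hbg14 laws leaves hcrit hloc hκ₀ hB₀ hB₁ hB₃ hC₁L hB₀B₁ hc₁ hO₁ hO₂ he₅ p2 p5 p6 p8 sF hζ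
      q2 q3 q4 q5 q6 q8 qF p9)

end Tower


/-! ## §4 κ₀ = 1: the printed tower at the torus of record, every statement at ONE constant -/

section KappaOne
variable {F : T4Family}

/-- **THE PRINTED TOWER AT THE TORUS OF RECORD (κ₀ = 1)**: with the two-tier parameter `κ₀ = 1` the repaired tower IS the printed tower of Sect. A
(`B11Thm1.Tower`, leaf (11) ⇒ (7) with the SAME ε₁ — at Ω_j = T the printed choice of V₀ has no interface), and the [B11] leaf at the bundle of record
follows with EVERY printed statement at the ONE constant `ζ.B₃` (no second instance): Theorem 1 and Proposition 7 derived, Props 2–6, 8, 9, Sect. F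
verbatim, bridges and dictionary residuals displayed, Sect. A proved. [cite: Balaban1985Variational, Thm 1 p.279, Sect. A (11)–(14) pp.279–280, Props 2–9 pp.281–309] -/
theorem b11Leaf_Z11OfRecord_of_towerT_parts_kappa_one (ζ : ResidZ F N)
    (β : ∀ i : ZIdx, Bridge (famXOfRecord F N ζ i) (ζ.famLG i)) (bg : ∀ i : ZIdx, GaugeField (F.P i.K) 0 (SU N) → (ζ.famLG i).Cfg)
    {O₁ O₂ e₅ : ℝ}
    (hbg14 : ∀ (i : ZIdx) (ε : ℝ) (V : GaugeField (F.P i.K) i.k (SU N)) (U : GaugeField (F.P i.K) 0 (SU N)),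
      InUkClassB11 F N i.K i.k (ζ.C₁ * ζ.B₃ * ε) U → Averaging.iter (avOfRecord F N i.K) i.k U = V →
        (ζ.famLG i).Sat14 (ζ.C₁ * ζ.B₃ * ε) (ζ.C₁ * ε) ((β i).bdry V) (bg i U))
    (laws : ∀ i, (β i).Laws ζ.C₁ ζ.B₃) (leaves : ∀ i, ExistenceLeavesCap (β i) ζ.B₀ ζ.B₃ ζ.C₁ O₁ O₂ e₅)
    (hcrit : ∀ (i : ZIdx) (e : ℝ) (V : GaugeField (F.P i.K) i.k (SU N)) (U : GaugeField (F.P i.K) 0 (SU N)),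
      IsBackground (avOfRecord F N i.K) {U | InUkClassB11 F N i.K i.k e U} i.k V U → ζ.IsCrit i V U)
    (hloc : ∀ (i : ZIdx) (e e' : ℝ) (V : GaugeField (F.P i.K) i.k (SU N)) (U : GaugeField (F.P i.K) 0 (SU N)), e' < e →
      IsBackground (avOfRecord F N i.K) {U | InUkClassB11 F N i.K i.k e' U} i.k V U →
        IsBackground (avOfRecord F N i.K) {U | InUkClassB11 F N i.K i.k e U} i.k V U)
    (hB₀ : 0 < ζ.B₀) (hB₁ : 0 < ζ.B₁) (hB₃ : 1 ≤ ζ.B₃) (hC₁L : (F.L : ℝ) ^ 3 ≤ ζ.C₁) (hB₀B₁ : ζ.B₀ ≤ 4 * ζ.B₁)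
    (hc₁ : 0 < ζ.c₁) (hO₁ : 0 < O₁) (hO₂ : 0 < O₂) (he₅ : 0 < e₅)
    (p2 : B11.Prop2Printed ζ.B₁ ζ.B₃ ζ.C₁ ζ.c₁ ζ.famLG) (p3 : B11.Prop3Printed ζ.C₁ ζ.B₃ ζ.C₂ ζ.C₃ ζ.B₀ ζ.c1h ζ.c₄ ζ.δ₀ ζ.famLG)
    (p4 : B11.Prop4Printed ζ.C₁ ζ.B₃ ζ.famLG) (p5 : B11.Prop5Printed ζ.B₁ ζ.B₃ ζ.C₁ ζ.famLG) (p6 : B11.Prop6Printed ζ.B₀ ζ.B₃ ζ.C₁ ζ.famLG)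
    (p8 : B11.Prop8Printed ζ.B₃ (famXOfRecord F N ζ)) (sF : B11.SectFPrinted ζ.B₃ (famXOfRecord F N ζ))
    (p9 : B11.Prop9Printed ζ.B₅ ζ.C₁ ζ.β₀ ζ.δ₀ ζ.famAn) :
    B11Leaf (Z11OfRecord F N ζ) :=
  b11Leaf_Z11OfRecord_of_towerT_parts ζ β bg (κ₀ := 1) (B₃ := ζ.B₃) hbg14 laws leaves hcrit hloc le_rfl hB₀ hB₁ hB₃ hC₁L hB₀B₁ hc₁ hO₁ hO₂
    he₅ p2 p5 p6 p8 sF (mul_one _).symm p2 p3 p4 p5 p6 p8 sF p9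

end KappaOne

end Summit.QuantumFields.YangMills.BalabanUVNodes.N07AtRecordTwoTier

end
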